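import Summits.QuantumFields.BalabanUV.T4Continuum.Support.NE7SliceIterationStateFacts
import Summits.QuantumFields.BalabanUV.T4Continuum.Support.NE3QuadRemainderLocal
import Summits.QuantumFields.BalabanUV.T4Continuum.Support.NE3QuadRemainderGaugeStep
import Summits.QuantumFields.BalabanUV.T4Continuum.Support.NE3CpushGaugeCovariance
import HarnessLib

/-!
# NE7SliceCoarseDatumLetter — THE COARSE DATUM OF AN (S1) STATE IS QUADRATIC (memo ROAD-G99 §3.9 (S1″) «φ = Q₂», ROAD-G102 §4): on the SHIFTED FIBRE `cavgIter(U′) = cavgIter(W)` the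
# relative coordinate satisfies the EXACT identity `relIter X(u) = log(V⁻¹·V^{e^{h(u)}})` (`V = cavgIter W`, `h(u)` the corner logs), hence
# `φ(u) = dirIter X(u) − gaugeDir_V h(u) = −[relIter − dirIter](X(u)) + [log(e^{Ad h(z)}e^{−h(z+e_κ)}) − (Ad h(z) − h(z+e_κ))]` and, by row NE3's quadratic-remainder letter
# (Π-C-3b∕3c) and ends-form BCH letter, `‖φ(u)(z,κ)‖ ≤ (4(3+12d)³∕ρ₀²)·(M·s)² + 4096·‖h(u)(z)‖·‖h(u)(z+e_κ)‖` (global sup `s` of `X(u)`; LOCAL form with the sup over the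
# dependency ball) — the pointwise input of the direct letters (DL1)∕(DL2) of `NE7DecompOfDirectLettersSlice.decomp_of_directLetters_coarse`

Cell `pub-balaban`, rung (B)+1 sub-cell t4, lineage `b2b-balaban-t4-ne7-p1`, generation 102 (CRUX PROVER NE7 #1 = OWNER of BINDER row NE7).  Memo `t4/b2b-balaban-t4-ne7-p1-g102/ROAD-G102.md` §4.
Bricks BY NAME: `NE3QuadRemainderSup.cavgIter_vary_eq_vary_relIter_of_tower` ∕ `norm_relIter_le` ∕ `norm_relIter_sub_dirIter_le` (Π-C-3b), `NE3QuadRemainderLocal.norm_relIter_sub_dirIter_le_local`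
(Π-C-3c), `NE3QuadRemainderGaugeStep.norm_mlog_exp_mul_exp_sub_le` (ends-form BCH), `NE3CpushGaugeCovariance.cavgIter_gaugeAct` (gauge covariance of the iterated average),
`NE7SliceIterationStateFacts` (the state's chart∕corners).  ONE LEVEL OF SLACK: the Π-C letters at the top level `K = k+1` ask `LevelSmall d L (k+1) x` (displayed as `hsK`).
WHAT ([folklore]; 0 def, 0 sorry).  §1 `relIter_eq_mlog_of_gauge_fibre` (abstract shifted fibre).  §2 `val_rel_gaugeAct_exp`, `norm_mlog_rel_gaugeAct_sub_gaugeDir_le` (the BCH reading of a coarse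
gauge action by `e^{h}`).  §3 at an (S1) state with `cavgIter U′ = cavgIter W`: **`relIter_repLog_eq`**, **`norm_relIter_repLog_sub_gaugeDir_le`**, **`norm_coarseDatum_le_rem`**,
**`norm_coarseDatum_le_sup`** (global sup form), **`norm_coarseDatum_le_local`** (local form).
HONEST FRAMING (page 1): exact kinematics + row NE3's letters BY NAME; the (DL1)∕(DL2) RATIO letters are NOT here (they need an ℓ²-regularity input for the slice representative, memo §4);
nothing of Bałaban's asserted; NOT (S2), NOT NE7; spine 0∕9; finite T⁴ rung (B)+1 — NOT infinite volume, NOT mass gap, NOT BetaPertH, NOT Clay.  Continuum YM on T⁴ ⇐ BetaPertH ∧ nine spine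
estimates (0/9 proved); BetaPertH ⇐ (D1) ∧ (D4) ∧ CAP+tail; G-an2-4 gates asym, D1 and NE2/3/4.
-/

set_option autoImplicit false

open scoped BigOperators Matrix.Norms.L2Operator
open NormedSpace Finset

namespace Summit.QuantumFields.BalabanUV.T4Continuum.NE7SliceCoarseDatumLetter

open Literature.MathematicalPhysics.QuantumFieldTheory.Balaban1983to89
open B7Prop1Explicit B7Prop2Explicit MatrixLog
open T4AveragingDeficitWall (IsUnitaryCfg IsSkewDir SmallField vary Ad)
open T4AveragingDeficitWallBoundary (IsPeriodicCfg periodBox)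
open AveragingDeficitPeriodicCounting (IsPeriodicDir)
open AveragingDeficitMultiLevelPrep (cavgIter LevelSmall tower cavgIter_unitary_small)
open AveragingDeficitTransport (norm_Ad_of_unitary)
open BlockAveragePushDirGauge (gaugeDir)
open BlockAverageVaryDisc (rho0 rho0_pos)
open NE3EnergyShapes (IsUnitarySite IsPeriodicSite)
open NE3TangentCovariantTower (dirIter)
open NE3LinearisedAverageSup (curvSum)
open NE3QuadRemainderTower (relIter)
open NE3QuadRemainderLocality (depRad)
open NE3QuadRemainderSup (norm_relIter_sub_dirIter_le norm_relIter_le cavgIter_vary_eq_vary_relIter_of_tower sigma_lines rho0_le_one)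
open NE3QuadRemainderLocal (norm_relIter_sub_dirIter_le_local)
open NE3QuadRemainderGaugeStep (norm_mlog_exp_mul_exp_sub_le)
open NE3CpushGaugeCovariance (cavgIter_gaugeAct)
open NE3QbarIterCovLiftPrep (cruxC)
open NE3FramePotBoundW (tower_eq_pow_mul levelSmall_pred)
open NE7SliceIterationState (repLog cornerLog coarseDatum)

noncomputable section

variable {d : ℕ} {n : Type*} [Fintype n] [DecidableEq n]

/-! ## §1 The shifted fibre: the relative coordinate is the log of a coarse gauge action -/

/-- **ON A SHIFTED FIBRE THE K-FOLD RELATIVE COORDINATE IS THE LOG OF THE COARSE GAUGE ACTION**: under the tower-class hypotheses of Π-C-3b, if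
`cavgIter L K (W·e^{X}) = (cavgIter L K W)^{c}` for a coarse gauge `c`, then `relIter L K W X (z,κ) = log(V(z,κ)⁻¹·V^{c}(z,κ))`, `V = cavgIter L K W`
(consistency `cavgIter(W e^X) = V·e^{relIter X}` and `log ∘ exp = id` on `‖·‖ < log 2`). [folklore] -/
theorem relIter_eq_mlog_of_gauge_fibre [Nonempty n] {L N K : ℕ} [NeZero N] (hL : 2 ≤ L) {W : Site d → Fin d → (Matrix n n ℂ)ˣ} {x : ℝ}
    (hWu : IsUnitaryCfg W) (hWP : IsPeriodicCfg W ((L ^ K * N : ℕ) : ℤ)) (hx : 0 ≤ x) (hsm : LevelSmall d L K x) (hWx : SmallField W x)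
    (hA : curvSum d L K x ≤ 2 / 3 * L) {X : Site d → Fin d → Matrix n n ℂ} (hXs : IsSkewDir X) (hXP : IsPeriodicDir X ((L ^ K * N : ℕ) : ℤ))
    {s : ℝ} (hs : 0 ≤ s) (hX : ∀ (z : Site d) (μ : Fin d), ‖X z μ‖ ≤ s)
    (hσ : 4 * (3 + 12 * (d : ℝ)) ^ 2 * (L : ℝ) ^ K * s ≤ rho0 d L ^ 2)
    {c : Site d → (Matrix n n ℂ)ˣ} (hfib : cavgIter L K (vary W X 1) = gaugeAct c (cavgIter L K W)) (z : Site d) (κ : Fin d) :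
    relIter L K W X z κ = mlog ((((cavgIter L K W z κ)⁻¹ : (Matrix n n ℂ)ˣ) : Matrix n n ℂ) * ((gaugeAct c (cavgIter L K W) z κ : (Matrix n n ℂ)ˣ) : Matrix n n ℂ)) := by
  have hc := cavgIter_vary_eq_vary_relIter_of_tower hL hWu hWP hx hsm hWx hA hXs hXP hs hX hσ (k := K) le_rfl
  rw [hfib] at hc
  have hb : gaugeAct c (cavgIter L K W) z κ = cavgIter L K W z κ * expUnit (((1 : ℝ) : ℂ) • relIter L K W X z κ) := congrFun (congrFun hc z) κ
  rw [Complex.ofReal_one, one_smul] at hb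
  have hval : (((cavgIter L K W z κ)⁻¹ : (Matrix n n ℂ)ˣ) : Matrix n n ℂ) * ((gaugeAct c (cavgIter L K W) z κ : (Matrix n n ℂ)ˣ) : Matrix n n ℂ)
      = exp (relIter L K W X z κ) := by
    rw [hb, Units.val_mul, ← mul_assoc, Units.inv_mul, one_mul, val_expUnit]
  have hsmall : ‖relIter L K W X z κ‖ < Real.log 2 := by
    have h1 := norm_relIter_le hL hWu hWP hx hsm hWx hA hXs hXP hs hX hσ (k := K) le_rfl z κ
    have h2 := (sigma_lines (d := d) hL hs hσ (i := K) le_rfl).1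
    have h3 := rho0_le_one (d := d) (L := L) (by omega)
    linarith [Real.log_two_gt_d9]
  rw [hval, B7BlockAvgLog.mlog_exp hsmall]

/-! ## §2 The BCH reading of a coarse gauge action by `e^{h}` -/

/-- `V(z,κ)⁻¹·V^{e^{h}}(z,κ) = e^{Ad_{V(z,κ)⁻¹}h(z)}·e^{−h(z+e_κ)}`. [folklore] -/
theorem val_rel_gaugeAct_exp (V : Site d → Fin d → (Matrix n n ℂ)ˣ) (h : Site d → Matrix n n ℂ) (z : Site d) (κ : Fin d) :
    (((V z κ)⁻¹ : (Matrix n n ℂ)ˣ) : Matrix n n ℂ) * ((gaugeAct (fun w => expUnit (h w)) V z κ : (Matrix n n ℂ)ˣ) : Matrix n n ℂ)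
      = exp (Ad (V z κ)⁻¹ (h z)) * exp (-h (z + e κ)) := by
  have hconj : exp (Ad (V z κ)⁻¹ (h z)) = (((V z κ)⁻¹ : (Matrix n n ℂ)ˣ) : Matrix n n ℂ) * exp (h z) * ((V z κ : (Matrix n n ℂ)ˣ) : Matrix n n ℂ) := by
    unfold Ad; rw [Matrix.exp_units_conj, inv_inv]
  rw [hconj, gaugeAct, Units.val_mul, Units.val_mul, val_expUnit]
  rw [show (((expUnit (h (z + e κ)))⁻¹ : (Matrix n n ℂ)ˣ) : Matrix n n ℂ) = exp (-h (z + e κ)) from rfl]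
  simp only [mul_assoc]

/-- **THE BCH READING**: for unitary `V(z,κ)` and `‖h(z)‖, ‖h(z+e_κ)‖ ≤ 1∕100`, `‖log(V(z,κ)⁻¹·V^{e^{h}}(z,κ)) − gaugeDir V h (z,κ)‖ ≤ 4096·‖h(z)‖·‖h(z+e_κ)‖` (row NE3's ends-form
letter `‖log(e^{A}e^{B}) − (A+B)‖ ≤ 4096‖A‖‖B‖` with `A = Ad_{V⁻¹}h(z)`, `B = −h(z+e_κ)`, `A + B = gaugeDir V h (z,κ)`). [folklore] -/
theorem norm_mlog_rel_gaugeAct_sub_gaugeDir_le [Nonempty n] {V : Site d → Fin d → (Matrix n n ℂ)ˣ} (hV : IsUnitaryCfg V) {h : Site d → Matrix n n ℂ} (z : Site d) (κ : Fin d)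
    (hz : ‖h z‖ ≤ 1 / 100) (hz' : ‖h (z + e κ)‖ ≤ 1 / 100) :
    ‖mlog ((((V z κ)⁻¹ : (Matrix n n ℂ)ˣ) : Matrix n n ℂ) * ((gaugeAct (fun w => expUnit (h w)) V z κ : (Matrix n n ℂ)ˣ) : Matrix n n ℂ)) - gaugeDir V h z κ‖
      ≤ 4096 * ‖h z‖ * ‖h (z + e κ)‖ := by
  rw [val_rel_gaugeAct_exp]
  have hAn : ‖Ad (V z κ)⁻¹ (h z)‖ = ‖h z‖ := norm_Ad_of_unitary ((unitaryUnits _).inv_mem (hV z κ)) (h z)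
  have hA : ‖Ad (V z κ)⁻¹ (h z)‖ ≤ 1 / 100 := hAn ▸ hz
  have hB : ‖-h (z + e κ)‖ ≤ 1 / 100 := by rw [norm_neg]; exact hz'
  have e : gaugeDir V h z κ = Ad (V z κ)⁻¹ (h z) + -h (z + e κ) := by rw [gaugeDir, sub_eq_add_neg]
  rw [e]
  have := norm_mlog_exp_mul_exp_sub_le hA hB
  rwa [hAn, norm_neg] at this

/-! ## §3 At an (S1) state on the shifted fibre `cavgIter U′ = cavgIter W` -/

section State

variable [Nonempty n] {L : ℕ} (hL : 2 ≤ L) (k : ℕ) {W : Site d → Fin d → (Matrix n n ℂ)ˣ} {x : ℝ} (hWu : IsUnitaryCfg W) (hx : 0 ≤ x) (hsK : LevelSmall d L (k + 1) x)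
  (hWx : SmallField W x) (N : ℕ) [NeZero N] (U' : Site d → Fin d → (Matrix n n ℂ)ˣ)
  (hWP : IsPeriodicCfg W ((tower L N (k + 1) : ℕ) : ℤ)) (hU'u : IsUnitaryCfg U') (hU'P : IsPeriodicCfg U' ((tower L N (k + 1) : ℕ) : ℤ))
  (hA : curvSum d L (k + 1) x ≤ 2 / 3 * L)
  {x' : ℝ} (hx'0 : 0 ≤ x') (hs' : LevelSmall d L k x') (hU'x : SmallField U' x')
  (htop : cavgIter L (k + 1) U' = cavgIter L (k + 1) W)
  {u : Site d → (Matrix n n ℂ)ˣ} (hu : IsUnitarySite u) (huP : IsPeriodicSite u ((tower L N (k + 1) : ℕ) : ℤ))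
  (hgauge : gaugeAct u U' = vary W (repLog W U' u) 1) (hX8 : ∀ y κ, ‖repLog W U' u y κ‖ ≤ 1 / 8)
  (hcorner : ∀ z, ((u (((L : ℤ) ^ (k + 1)) • z) : (Matrix n n ℂ)ˣ) : Matrix n n ℂ) = exp (cornerLog L k u z))
  {s : ℝ} (hs0 : 0 ≤ s) (hXs : ∀ y κ, ‖repLog W U' u y κ‖ ≤ s) (hσ : 4 * (3 + 12 * (d : ℝ)) ^ 2 * (L : ℝ) ^ (k + 1) * s ≤ rho0 d L ^ 2)

include hL hU'u hx'0 hs' hU'x htop hu hgauge hcorner in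
/-- **THE SHIFTED FIBRE OF THE STATE**: `cavgIter(W·e^{X(u)}) = (cavgIter W)^{e^{h(u)}}` — the chart `U′^{u} = W·e^{X(u)}`, gauge covariance of the iterated average
(`cavgIter(U′^{u}) = (cavgIter U′)^{u∘(M•)}`), `cavgIter U′ = cavgIter W`, and the corners `u(M•z) = e^{h(u) z}`. [folklore] -/
theorem cavgIter_state_eq_gaugeAct :
    cavgIter L (k + 1) (vary W (repLog W U' u) 1) = gaugeAct (fun w => expUnit (cornerLog L k u w)) (cavgIter L (k + 1) W) := by
  have hL1 : 1 ≤ L := by omega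
  have hc : (fun w => u (((L : ℤ) ^ (k + 1)) • w)) = fun w => expUnit (cornerLog L k u w) := by
    funext w; exact Units.ext (by rw [val_expUnit]; exact hcorner w)
  rw [← hgauge, cavgIter_gaugeAct hL1 k hU'u hx'0 hs' hU'x hu, htop, hc]

include hL hWu hx hsK hWx hWP hU'u hU'P hA hx'0 hs' hU'x htop hu huP hgauge hX8 hcorner hs0 hXs hσ in
/-- **`relIter X(u) = log(V⁻¹·V^{e^{h(u)}})`** at an (S1) state on the shifted fibre (`V = cavgIter L (k+1) W`). [folklore] -/
theorem relIter_repLog_eq (z : Site d) (κ : Fin d) :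
    relIter L (k + 1) W (repLog W U' u) z κ
      = mlog ((((cavgIter L (k + 1) W z κ)⁻¹ : (Matrix n n ℂ)ˣ) : Matrix n n ℂ)
          * ((gaugeAct (fun w => expUnit (cornerLog L k u w)) (cavgIter L (k + 1) W) z κ : (Matrix n n ℂ)ˣ) : Matrix n n ℂ)) := by
  have hWP' : IsPeriodicCfg W ((L ^ (k + 1) * N : ℕ) : ℤ) := by rw [← tower_eq_pow_mul]; exact hWP
  have hXsk := NE7SliceIterationStateFacts.repLog_skew hWu U' hU'u hu hgauge hX8
  have hXP : IsPeriodicDir (repLog W U' u) ((L ^ (k + 1) * N : ℕ) : ℤ) := by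
    rw [← tower_eq_pow_mul]; exact NE7SliceIterationStateFacts.repLog_periodic k N U' hWP hU'P huP
  exact relIter_eq_mlog_of_gauge_fibre hL hWu hWP' hx hsK hWx hA hXsk hXP hs0 hXs hσ
    (cavgIter_state_eq_gaugeAct hL k U' hU'u hx'0 hs' hU'x htop hu hgauge hcorner) z κ

include hL hWu hx hsK hWx hWP hU'u hU'P hA hx'0 hs' hU'x htop hu huP hgauge hX8 hcorner hs0 hXs hσ in
/-- **`‖relIter X(u) (z,κ) − gaugeDir_V h(u) (z,κ)‖ ≤ 4096·‖h(u)(z)‖·‖h(u)(z+e_κ)‖`** when `‖h(u)(z)‖, ‖h(u)(z+e_κ)‖ ≤ 1∕100`. [folklore] -/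
theorem norm_relIter_repLog_sub_gaugeDir_le (z : Site d) (κ : Fin d) (hz : ‖cornerLog L k u z‖ ≤ 1 / 100) (hz' : ‖cornerLog L k u (z + e κ)‖ ≤ 1 / 100) :
    ‖relIter L (k + 1) W (repLog W U' u) z κ - gaugeDir (cavgIter L (k + 1) W) (cornerLog L k u) z κ‖
      ≤ 4096 * ‖cornerLog L k u z‖ * ‖cornerLog L k u (z + e κ)‖ := by
  have hL1 : 1 ≤ L := by omega
  rw [relIter_repLog_eq hL k hWu hx hsK hWx N U' hWP hU'u hU'P hA hx'0 hs' hU'x htop hu huP hgauge hX8 hcorner hs0 hXs hσ z κ]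
  have hVu : IsUnitaryCfg (cavgIter L (k + 1) W) := (cavgIter_unitary_small hL1 k hWu hx (levelSmall_pred k hsK) hWx).1
  exact norm_mlog_rel_gaugeAct_sub_gaugeDir_le hVu z κ hz hz'

include hL hWu hx hsK hWx hWP hU'u hU'P hA hx'0 hs' hU'x htop hu huP hgauge hX8 hcorner hs0 hXs hσ in
/-- **THE COARSE DATUM IS A SUM OF TWO QUADRATIC REMAINDERS**: `‖φ(u)(z,κ)‖ ≤ ‖[relIter − dirIter] X(u) (z,κ)‖ + 4096·‖h(u)(z)‖·‖h(u)(z+e_κ)‖`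
(`φ(u) = dirIter X(u) − gaugeDir_V h(u) = −(relIter − dirIter)X(u) + (relIter X(u) − gaugeDir_V h(u))`). [folklore] -/
theorem norm_coarseDatum_le_rem (z : Site d) (κ : Fin d) (hz : ‖cornerLog L k u z‖ ≤ 1 / 100) (hz' : ‖cornerLog L k u (z + e κ)‖ ≤ 1 / 100) :
    ‖coarseDatum L k W U' u z κ‖
      ≤ ‖relIter L (k + 1) W (repLog W U' u) z κ - dirIter L (k + 1) W (repLog W U' u) z κ‖ + 4096 * ‖cornerLog L k u z‖ * ‖cornerLog L k u (z + e κ)‖ := by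
  have h2 := norm_relIter_repLog_sub_gaugeDir_le hL k hWu hx hsK hWx N U' hWP hU'u hU'P hA hx'0 hs' hU'x htop hu huP hgauge hX8 hcorner hs0 hXs hσ z κ hz hz'
  have e : coarseDatum L k W U' u z κ
      = -(relIter L (k + 1) W (repLog W U' u) z κ - dirIter L (k + 1) W (repLog W U' u) z κ)
        + (relIter L (k + 1) W (repLog W U' u) z κ - gaugeDir (cavgIter L (k + 1) W) (cornerLog L k u) z κ) := by
    simp only [coarseDatum]; abel
  rw [e]
  exact (norm_add_le _ _).trans (by rw [norm_neg]; linarith)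

include hL hWu hx hsK hWx hWP hU'u hU'P hA hx'0 hs' hU'x htop hu huP hgauge hX8 hcorner hs0 hXs hσ in
/-- **THE COARSE DATUM IS QUADRATIC, GLOBAL SUP FORM**: with `s ≥ sup‖X(u)‖` (`4(3+12d)²·M·s ≤ ρ₀²`) and `η ≥ sup‖h(u)‖` (`η ≤ 1∕100`),
`‖φ(u)(z,κ)‖ ≤ (4(3+12d)³∕ρ₀²)·(M·s)² + 4096·η²` — row NE3's Π-C-3b END + the BCH reading. [folklore] -/
theorem norm_coarseDatum_le_sup {η : ℝ} (hη : ∀ z, ‖cornerLog L k u z‖ ≤ η) (hη1 : η ≤ 1 / 100) (z : Site d) (κ : Fin d) :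
    ‖coarseDatum L k W U' u z κ‖ ≤ 4 * (3 + 12 * (d : ℝ)) ^ 3 / rho0 d L ^ 2 * ((L : ℝ) ^ (k + 1) * s) ^ 2 + 4096 * η ^ 2 := by
  have hη0 : 0 ≤ η := (norm_nonneg _).trans (hη z)
  have hWP' : IsPeriodicCfg W ((L ^ (k + 1) * N : ℕ) : ℤ) := by rw [← tower_eq_pow_mul]; exact hWP
  have hXsk := NE7SliceIterationStateFacts.repLog_skew hWu U' hU'u hu hgauge hX8
  have hXP : IsPeriodicDir (repLog W U' u) ((L ^ (k + 1) * N : ℕ) : ℤ) := by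
    rw [← tower_eq_pow_mul]; exact NE7SliceIterationStateFacts.repLog_periodic k N U' hWP hU'P huP
  have h1 := norm_relIter_sub_dirIter_le hL hWu hWP' hx hsK hWx hA hXsk hXP hs0 hXs hσ (k + 1) le_rfl z κ
  have h2 := norm_coarseDatum_le_rem hL k hWu hx hsK hWx N U' hWP hU'u hU'P hA hx'0 hs' hU'x htop hu huP hgauge hX8 hcorner hs0 hXs hσ z κ
    ((hη z).trans hη1) ((hη _).trans hη1)
  have h3 : 4096 * ‖cornerLog L k u z‖ * ‖cornerLog L k u (z + e κ)‖ ≤ 4096 * η ^ 2 := by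
    have := mul_le_mul (hη z) (hη (z + e κ)) (norm_nonneg _) hη0
    nlinarith
  linarith

include hL hWu hx hsK hWx hWP hU'u hU'P hA hx'0 hs' hU'x htop hu huP hgauge hX8 hcorner hs0 hXs hσ in
/-- **THE COARSE DATUM IS QUADRATIC, LOCAL FORM**: with a LOCAL sup `t` of `X(u)` on the dependency ball `{y : l1(y − M•z) ≤ depRad d L (k+1)}` (`4(3+12d)²·M·t ≤ ρ₀²`),
`‖φ(u)(z,κ)‖ ≤ (4(3+12d)³∕ρ₀²)·(M·t)² + 4096·‖h(u)(z)‖·‖h(u)(z+e_κ)‖` — Π-C-3c's LOCAL END + the BCH reading; the pointwise shape `‖φ(z,κ)‖ ≤ C₂·(M·m(z,κ))² + …` of row NE3's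
`NE3LinearNormalPartPreSizes.dirSq_coarse_le`. [folklore] -/
theorem norm_coarseDatum_le_local (z : Site d) (κ : Fin d) (hz : ‖cornerLog L k u z‖ ≤ 1 / 100) (hz' : ‖cornerLog L k u (z + e κ)‖ ≤ 1 / 100)
    {t : ℝ} (ht : 0 ≤ t) (hloc : ∀ (y : Site d) (μ : Fin d), l1 (y - ((L : ℤ) ^ (k + 1)) • z) ≤ depRad d L (k + 1) → ‖repLog W U' u y μ‖ ≤ t)
    (hσt : 4 * (3 + 12 * (d : ℝ)) ^ 2 * (L : ℝ) ^ (k + 1) * t ≤ rho0 d L ^ 2) :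
    ‖coarseDatum L k W U' u z κ‖ ≤ 4 * (3 + 12 * (d : ℝ)) ^ 3 / rho0 d L ^ 2 * ((L : ℝ) ^ (k + 1) * t) ^ 2 + 4096 * ‖cornerLog L k u z‖ * ‖cornerLog L k u (z + e κ)‖ := by
  have hWP' : IsPeriodicCfg W ((L ^ (k + 1) * N : ℕ) : ℤ) := by rw [← tower_eq_pow_mul]; exact hWP
  have hXsk := NE7SliceIterationStateFacts.repLog_skew hWu U' hU'u hu hgauge hX8
  have hXP : IsPeriodicDir (repLog W U' u) ((L ^ (k + 1) * N : ℕ) : ℤ) := by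
    rw [← tower_eq_pow_mul]; exact NE7SliceIterationStateFacts.repLog_periodic k N U' hWP hU'P huP
  have h1 := norm_relIter_sub_dirIter_le_local hL hWu hWP' hx hsK hWx hA hXsk hXP (k := k + 1) le_rfl z ht hloc hσt κ
  have h2 := norm_coarseDatum_le_rem hL k hWu hx hsK hWx N U' hWP hU'u hU'P hA hx'0 hs' hU'x htop hu huP hgauge hX8 hcorner hs0 hXs hσ z κ hz hz'
  linarith

end State

end

end Summit.QuantumFields.BalabanUV.T4Continuum.NE7SliceCoarseDatumLetter
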